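/- Copyright: the b2b-balaban cell (near-miss cell 7), T⁴-continuum fan-out; row NE7b ROUND-2 swarm, seat
t4-ne7b-formalise-leaf-06 (gen 8) (road W-RP, sub-row «W-LAB», file 11a: BOX PLAQUETTES UNDER THE CENTRE REFLECTION —
the plaquette twin of W3o-3's bond geometry; supplier of file 11b's plaquette reader; INTENT journal l.19807).
Released under the licence of the surrounding project. -/
import Summits.QuantumFields.BalabanUV.T4Continuum.Support.HistoryRPTowerUniform

/-!
# Road W-RP, sub-row «W-LAB», file 11a: BOX PLAQUETTES — box-measurability and the centre reflection in `dist1`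

Summits-side support leaf of the T⁴-continuum cell (rung (B)+1 on a FINITE torus only; NOT infinite volume, NOT the
mass gap, NOT the Clay statement; NOT a proof of the spine estimate NE7b).  Row NE7b, road **W-RP** (R-OWNER-23-2 ∕
R-OWNER-23-8), sub-row «W-LAB», file 11a (supplier of file 11b `HistoryChessboardPlaquetteReader`): the PLAQUETTE twin
of the bond geometry of W3o files 1∕3 (`HistoryRPTowerTemplates`: `boxBonds`, `boxAlg`, `measurable_coord_boxAlg`;
`HistoryRPTowerUniform`: `axisVec`, `val_add_natCast_lt_iff`, `cbond_mem_boxBonds_iff`, `preimage_creflect_boxSet`), on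
top of W3f (`HistoryRPHalfTorus`: `GaugeField.creflect`, `zero_unshift_apply`), the tree's `TorusHypercubicSymmetry`
(`Plaq.reflect`, `GaugeField.reflect`, `reTr_plaqHol_reflect` — whose `dist1` twin §2 proves), `TorusLimitAxioms`
(`Plaq.translate`, `plaqHol_translate`) and the tree's small-field predicate `Setup.PlaqSmallOn S δ U := ∀ p ∈ S,
dist1 (U(∂p)) < δ` (the `[cite]`-tagged definition of B12 (0.18) ∕ B14 (1.4), imported — not restated).  [folklore]
bookkeeping of the symmetry ∕ measurability of OUR lattice carriers; DATA defs `boxPlaqs` (a `Finset` filter) and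
`cplaq`; no `structure`, no `[cite:]` tag, no `Prop`-valued FACT minted (c1), no constant of print (c2∕c6), no exit ∕
socket ∕ `HistoryConstants` file touched (c3); nothing of W3o ∕ W3f ∕ the tree restated.

WHY.  W-LAB file 10 read the reference cube column through BOND variables `U(b) ∈ A`.  Bałaban's small-field conditions
are stated on PLAQUETTE variables (`|U(∂p) − 1| < ε`: B12 p. 254 ∕ (1.2), B14 (1.1), B15 (1.3)), i.e. in the tree's
`PlaqSmallOn`.  To make `read_meas` ∕ `read_sym` THEOREMS for a plaquette reader (file 11b) one needs, at ONE level: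
(a) for a plaquette `p` inside the box, `U ↦ U(∂p)` is measurable for the box σ-algebra — its four letters are box bonds
(§1) and `RegularGaugeGroup` supplies `MeasurableMul₂` ∕ `MeasurableInv`; (b) the centre reflection `c_i` of fields
acts on `dist1` of plaquette variables by the centre reflection of PLAQUETTES, `dist1 ((c_i U)(∂p)) = dist1 (U(∂(c_i
p)))` — `dist1` is a class function invariant under inversion (`GaugeGroup.dist1_conj` ∕ `dist1_inv`), so the
orientation reversal of the reflected square is invisible (§2, the `dist1` twin of the tree's `reTr_plaqHol_reflect`);
(c) `c_i` carries the plaquette box onto the mirror box `p ↦ p + s·e_i` (§2, the plaquette twin of W3o-3's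
`cbond_mem_boxBonds_iff`).  Together: the `PlaqSmallOn` box event pulled back by `c_i` is its pull-back by the
translation to the mirror box (`preimage_creflect_plaqSmallOn`, the plaquette twin of W3o-3's
`preimage_creflect_boxSet`).

WHAT.
* §1 `boxPlaqs P j s` (plaquettes with all four corners' labels `< s`), `mem_boxPlaqs`, `shift_shift_apply`,
  `letters_mem_boxBonds`, **`measurable_plaqHol_boxAlg`**, **`measurableSet_plaqSmallOn_boxAlg`**.
* §2 `dist1_pattern₁∕₂`, **`dist1_plaqHol_reflect`** (`dist1 ((r_μ U)(∂p)) = dist1 (U(∂(r_μ p)))`), `cplaq i p :=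
  (p.reflect i).translate (−e_i)`, `cplaq_μ∕ν`, `cplaq_src_apply_same ∕ _of_ne`, `cplaq_cplaq`,
  `plaq_translate_translate`, `plaq_translate_zero`, **`dist1_plaqHol_creflect`**, `val_neg_sub_one_lt_iff`,
  **`cplaq_mem_boxPlaqs_iff`** (`s ≤ N_j`), **`preimage_creflect_plaqSmallOn`**.

HONEST SCOPE (R-OWNER-23-8 wording for road W-RP).  Lattice symmetry ∕ measurability bookkeeping of OUR carriers for the
tree's typed small-field predicate; discharges nothing of (EXT) ∕ (U1) ∕ (G2) ∕ H3 ∕ (B) ∕ BetaPertH ∕ NE7c ∕ NE7; no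
headline touched; 0∕9 unchanged.  NE7b NOT proved; spine 0∕9.  HONEST DEPENDENCY (cell): continuum YM on T⁴ ⇐ BetaPertH
∧ nine spine estimates (0/9 proved); BetaPertH ⇐ (D1) ∧ (D4) ∧ CAP+tail; G-an2-4 gates asym, D1 and NE2/3/4.  This file
changes none of it.
-/

open MeasureTheory
open Literature.MathematicalPhysics.QuantumFieldTheory
open Literature.MathematicalPhysics.QuantumFieldTheory.Balaban1983to89
open T4UndoubledRP
open Summit.QuantumFields.BalabanUV.T4Continuum HistoryRPHalfTorus HistoryRPTowerLaw HistoryRPTowerCuts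
open HistoryRPTowerCells HistoryRPTowerTemplates HistoryRPTowerColumns HistoryRPTowerUniform

namespace Summit.QuantumFields.BalabanUV.T4Continuum.HistoryChessboardPlaquetteBox

noncomputable section

variable {P : Params} {G : Type*}

/-! ## §1 Box plaquettes: their letters are box bonds; plaquette variables are box-measurable -/

section Box

/-- **THE BOX PLAQUETTES of side `s` at level `j`**: all four corners carry labels `< s` in EVERY direction (it suffices
to ask it of the corners `x` and `x + e_μ + e_ν`). -/
def boxPlaqs (P : Params) (j s : ℕ) : Finset (Plaq P j) :=
  Finset.univ.filter fun p => ∀ κ : Fin P.d, (p.src κ).val < s ∧ (((p.src.shift p.μ).shift p.ν) κ).val < s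

/-- membership in `boxPlaqs`. [folklore] -/
@[simp] theorem mem_boxPlaqs {j s : ℕ} {p : Plaq P j} :
    p ∈ boxPlaqs P j s ↔ ∀ κ : Fin P.d, (p.src κ).val < s ∧ (((p.src.shift p.μ).shift p.ν) κ).val < s := by
  simp [boxPlaqs]

/-- the far corner's labels: `(x + e_μ + e_ν)_κ = x_κ + [κ = μ] + [κ = ν]`. [folklore] -/
theorem shift_shift_apply {j : ℕ} (x : Site P j) (μ ν κ : Fin P.d) :
    ((x.shift μ).shift ν) κ = x κ + (if κ = μ then 1 else 0) + (if κ = ν then 1 else 0) := by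
  simp only [Balaban1983to89.Site.shift_apply]
  by_cases hν : κ = ν
  · subst hν
    by_cases hμ : κ = μ
    · subst hμ; simp
    · simp [hμ]
  · by_cases hμ : κ = μ
    · subst hμ; simp [hν]
    · simp [hμ, hν]

/-- **THE FOUR LETTERS OF A BOX PLAQUETTE ARE BOX BONDS** (W3o's `boxBonds`: both endpoints' labels `< s`).
[folklore] -/
theorem letters_mem_boxBonds {j s : ℕ} {p : Plaq P j} (hp : p ∈ boxPlaqs P j s) :
    (⟨p.src, p.μ⟩ : PBond P j) ∈ boxBonds P j s ∧ (⟨p.src.shift p.μ, p.ν⟩ : PBond P j) ∈ boxBonds P j s ∧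
      (⟨p.src.shift p.ν, p.μ⟩ : PBond P j) ∈ boxBonds P j s ∧ (⟨p.src, p.ν⟩ : PBond P j) ∈ boxBonds P j s := by
  rw [mem_boxPlaqs] at hp
  have hne : p.μ ≠ p.ν := p.hμν.ne
  have hμ : ∀ κ, ((p.src.shift p.μ) κ).val < s := fun κ => by
    obtain ⟨h1, h2⟩ := hp κ
    rw [shift_shift_apply] at h2
    rw [Balaban1983to89.Site.shift_apply]
    by_cases hκ : κ = p.μ
    · have hκν : κ ≠ p.ν := fun h => hne (hκ.symm.trans h)
      rw [if_pos hκ]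
      rw [if_pos hκ, if_neg hκν, add_zero, hκ] at h2
      exact h2
    · rw [if_neg hκ]; exact h1
  have hν : ∀ κ, ((p.src.shift p.ν) κ).val < s := fun κ => by
    obtain ⟨h1, h2⟩ := hp κ
    rw [shift_shift_apply] at h2
    rw [Balaban1983to89.Site.shift_apply]
    by_cases hκ : κ = p.ν
    · have hκμ : κ ≠ p.μ := fun h => hne (h.symm.trans hκ)
      rw [if_pos hκ]
      rw [if_neg hκμ, add_zero, if_pos hκ, hκ] at h2
      exact h2
    · rw [if_neg hκ]; exact h1
  have hμν : ∀ κ, (((p.src.shift p.μ).shift p.ν) κ).val < s := fun κ => (hp κ).2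
  refine ⟨mem_boxBonds.2 fun κ => ⟨(hp κ).1, hμ κ⟩, mem_boxBonds.2 fun κ => ⟨hμ κ, hμν κ⟩,
    mem_boxBonds.2 fun κ => ⟨hν κ, ?_⟩, mem_boxBonds.2 fun κ => ⟨(hp κ).1, hν κ⟩⟩
  show (((p.src.shift p.ν).shift p.μ) κ).val < s
  rw [← Balaban1983to89.Site.shift_comm]
  exact hμν κ

variable [GaugeGroup G] [MeasurableSpace G]

/-- **THE PLAQUETTE VARIABLE OF A BOX PLAQUETTE IS BOX-MEASURABLE**: `Measurable[boxAlg G j s] (U ↦ U(∂p))` for `p ∈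
boxPlaqs P j s` (its four letters are box coordinates, `measurable_coord_boxAlg`; products ∕ inverses by
`MeasurableMul₂` ∕ `MeasurableInv`). [folklore] -/
theorem measurable_plaqHol_boxAlg [MeasurableMul₂ G] [MeasurableInv G] {j s : ℕ} {p : Plaq P j}
    (hp : p ∈ boxPlaqs P j s) :
    Measurable[boxAlg G j s] fun U : GaugeField P j G => GaugeField.plaqHol U p := by
  obtain ⟨h1, h2, h3, h4⟩ := letters_mem_boxBonds hp
  unfold GaugeField.plaqHol
  exact (((measurable_coord_boxAlg h1).mul (measurable_coord_boxAlg h2)).mul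
    (measurable_coord_boxAlg h3).inv).mul (measurable_coord_boxAlg h4).inv

/-- **`PlaqSmallOn` ON THE BOX PLAQUETTES IS A BOX EVENT**: `{U | PlaqSmallOn (boxPlaqs P j s) δ U}` is
`boxAlg G j s`-measurable (`RegularGaugeGroup.measurable_dist1`). [folklore] -/
theorem measurableSet_plaqSmallOn_boxAlg [RegularGaugeGroup G] (j s : ℕ) (δ : ℝ) :
    MeasurableSet[boxAlg G j s] {U : GaugeField P j G | PlaqSmallOn (↑(boxPlaqs P j s)) δ U} := by
  have : {U : GaugeField P j G | PlaqSmallOn (↑(boxPlaqs P j s)) δ U} =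
      ⋂ p ∈ boxPlaqs P j s, {U | dist1 (GaugeField.plaqHol U p) < δ} := by
    ext U
    simp only [PlaqSmallOn, Finset.mem_coe, Set.mem_setOf_eq, Set.mem_iInter]
  rw [this]
  exact MeasurableSet.biInter (Finset.countable_toSet _) fun p hp =>
    (RegularGaugeGroup.measurable_dist1.comp (measurable_plaqHol_boxAlg hp)) measurableSet_Iio

end Box

/-! ## §2 The centre reflection on plaquette variables (`dist1`) and on the plaquette box -/

section Reflect

variable [GaugeGroup G] {j : ℕ}

/-- `dist1 (g₁⁻¹ g₄ g₃ g₂⁻¹) = dist1 (g₁ g₂ g₃⁻¹ g₄⁻¹)` (a conjugate of the inverse; `dist1_conj`, `dist1_inv` — the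
`dist1` twin of the tree's `reTr_pattern₁`). [folklore] -/
theorem dist1_pattern₁ (g₁ g₂ g₃ g₄ : G) : dist1 (g₁⁻¹ * g₄ * g₃ * g₂⁻¹) = dist1 (g₁ * g₂ * g₃⁻¹ * g₄⁻¹) := by
  have h : g₁⁻¹ * g₄ * g₃ * g₂⁻¹ = g₁⁻¹ * (g₁ * g₂ * g₃⁻¹ * g₄⁻¹)⁻¹ * g₁⁻¹⁻¹ := by group
  rw [h, GaugeGroup.dist1_conj, GaugeGroup.dist1_inv]

/-- `dist1 (g₃ g₂⁻¹ g₁⁻¹ g₄) = dist1 (g₁ g₂ g₃⁻¹ g₄⁻¹)` (the `dist1` twin of the tree's `reTr_pattern₂`). [folklore] -/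
theorem dist1_pattern₂ (g₁ g₂ g₃ g₄ : G) : dist1 (g₃ * g₂⁻¹ * g₁⁻¹ * g₄) = dist1 (g₁ * g₂ * g₃⁻¹ * g₄⁻¹) := by
  have h : g₃ * g₂⁻¹ * g₁⁻¹ * g₄ = g₄⁻¹ * (g₁ * g₂ * g₃⁻¹ * g₄⁻¹)⁻¹ * g₄⁻¹⁻¹ := by group
  rw [h, GaugeGroup.dist1_conj, GaugeGroup.dist1_inv]

/-- **PLAQUETTE VARIABLES ARE REFLECTION COVARIANT IN `dist1`**: `dist1 ((r_μ U)(∂p)) = dist1 (U(∂(r_μ p)))` — the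
`dist1` twin of the tree's `GaugeField.reTr_plaqHol_reflect` (same three cases; for `μ` a direction of `p` the image
square is traversed in the opposite sense from another corner, a conjugate of the inverse, invisible to `dist1`).
[folklore] -/
theorem dist1_plaqHol_reflect (μ : Fin P.d) (U : GaugeField P j G) (p : Plaq P j) :
    dist1 (GaugeField.plaqHol (U.reflect μ) p) = dist1 (GaugeField.plaqHol U (p.reflect μ)) := by
  obtain ⟨x, a, b, hab⟩ := p
  simp only [GaugeField.plaqHol_eq_holAt, Plaq.reflect]
  by_cases ha : a = μ
  · subst ha
    rw [if_pos (Or.inl rfl)]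
    have hb : b ≠ a := hab.ne'
    have e1 : U.reflect a ⟨x, a⟩ = (U ⟨(x.shift a).reflect a, a⟩)⁻¹ := by
      simp [GaugeField.reflect_apply, PBond.reflect]
    have e2 : U.reflect a ⟨x.shift a, b⟩ = U ⟨(x.shift a).reflect a, b⟩ := by
      simp [GaugeField.reflect_apply, PBond.reflect, hb]
    have e3 : U.reflect a ⟨x.shift b, a⟩ = (U ⟨((x.shift a).reflect a).shift b, a⟩)⁻¹ := by
      simp [GaugeField.reflect_apply, PBond.reflect, Site.shift_comm x b a, Site.shift_reflect_of_ne a _ hb]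
    have e4 : U.reflect a ⟨x, b⟩ = U ⟨((x.shift a).reflect a).shift a, b⟩ := by
      simp [GaugeField.reflect_apply, PBond.reflect, hb, Site.shift_reflect_shift]
    simp only [GaugeField.holAt, e1, e2, e3, e4, inv_inv]
    exact dist1_pattern₁ _ _ _ _
  · by_cases hb : b = μ
    · subst hb
      rw [if_pos (Or.inr rfl)]
      have e1 : U.reflect b ⟨x, a⟩ = U ⟨((x.shift b).reflect b).shift b, a⟩ := by
        simp [GaugeField.reflect_apply, PBond.reflect, ha, Site.shift_reflect_shift]
      have e2 : U.reflect b ⟨x.shift a, b⟩ = (U ⟨((x.shift b).reflect b).shift a, b⟩)⁻¹ := by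
        simp [GaugeField.reflect_apply, PBond.reflect, Site.shift_comm x a b, Site.shift_reflect_of_ne b _ ha]
      have e3 : U.reflect b ⟨x.shift b, a⟩ = U ⟨(x.shift b).reflect b, a⟩ := by
        simp [GaugeField.reflect_apply, PBond.reflect, ha]
      have e4 : U.reflect b ⟨x, b⟩ = (U ⟨(x.shift b).reflect b, b⟩)⁻¹ := by
        simp [GaugeField.reflect_apply, PBond.reflect]
      simp only [GaugeField.holAt, e1, e2, e3, e4, inv_inv]
      exact dist1_pattern₂ _ _ _ _
    · rw [if_neg (not_or.mpr ⟨ha, hb⟩)]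
      congr 1
      simp [GaugeField.holAt, GaugeField.reflect_apply, PBond.reflect, ha, hb, Site.shift_reflect_of_ne μ _ ha,
        Site.shift_reflect_of_ne μ _ hb]

/-- **THE CENTRE-REFLECTED PLAQUETTE** `c_i p`: `Plaq.reflect` followed by the translation by `−e_i` (the plaquette twin
of W3f's `cbond`; same directions). -/
def cplaq (i : Fin P.d) (p : Plaq P j) : Plaq P j := (p.reflect i).translate ((0 : Site P j).unshift i)

/-- directions of `cplaq`. [folklore] -/
@[simp] theorem cplaq_μ (i : Fin P.d) (p : Plaq P j) : (cplaq i p).μ = p.μ := rfl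

/-- directions of `cplaq`. [folklore] -/
@[simp] theorem cplaq_ν (i : Fin P.d) (p : Plaq P j) : (cplaq i p).ν = p.ν := rfl

/-- the `i`-label of the base point of `c_i p`: `−x_i − 1`, lowered by one more step when `i` is a direction of `p` (the
image square hangs on the negative side). [folklore] -/
theorem cplaq_src_apply_same (i : Fin P.d) (p : Plaq P j) :
    (cplaq i p).src i = -(p.src i) - 1 - (if p.μ = i ∨ p.ν = i then 1 else 0) := by
  obtain ⟨x, a, b, hab⟩ := p
  simp only [cplaq, Plaq.translate, Plaq.reflect, Balaban1983to89.Site.add_apply, zero_unshift_apply, if_true]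
  split_ifs with h
  · rw [Balaban1983to89.Site.reflect_apply, if_pos rfl, Balaban1983to89.Site.shift_apply, if_pos rfl]; ring
  · rw [Balaban1983to89.Site.reflect_apply, if_pos rfl]; ring

/-- the other labels of the base point of `c_i p` are those of `p`. [folklore] -/
theorem cplaq_src_apply_of_ne (i : Fin P.d) (p : Plaq P j) {κ : Fin P.d} (hκ : κ ≠ i) :
    (cplaq i p).src κ = p.src κ := by
  obtain ⟨x, a, b, hab⟩ := p
  simp only [cplaq, Plaq.translate, Plaq.reflect, Balaban1983to89.Site.add_apply, zero_unshift_apply, if_neg hκ,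
    add_zero]
  split_ifs with h
  · rw [Balaban1983to89.Site.reflect_apply, if_neg hκ, Balaban1983to89.Site.shift_apply, if_neg hκ]
  · rw [Balaban1983to89.Site.reflect_apply, if_neg hκ]

/-- **`cplaq` IS AN INVOLUTION.** [folklore] -/
theorem cplaq_cplaq (i : Fin P.d) (p : Plaq P j) : cplaq i (cplaq i p) = p := by
  obtain ⟨x, a, b, hab⟩ := p
  simp only [cplaq, Plaq.translate, Plaq.reflect, Plaq.mk.injEq, and_true]
  funext κ
  by_cases hd : a = i ∨ b = i
  · simp only [if_pos hd, Balaban1983to89.Site.add_apply, zero_unshift_apply, Balaban1983to89.Site.reflect_apply,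
      Balaban1983to89.Site.shift_apply]
    by_cases hκ : κ = i
    · subst hκ; simp only [if_true]; ring
    · simp only [if_neg hκ, add_zero]
  · simp only [if_neg hd, Balaban1983to89.Site.add_apply, zero_unshift_apply, Balaban1983to89.Site.reflect_apply]
    by_cases hκ : κ = i
    · subst hκ; simp only [if_true]; ring
    · simp only [if_neg hκ, add_zero]

/-- two plaquette translations compose to the translation by the sum. [folklore] -/
theorem plaq_translate_translate (a a' : Site P j) (p : Plaq P j) :
    (p.translate a).translate a' = p.translate (a + a') := by
  obtain ⟨x, μ, ν, h⟩ := p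
  simp only [Plaq.translate, add_assoc]

/-- translation of a plaquette by `0`. [folklore] -/
theorem plaq_translate_zero (p : Plaq P j) : p.translate (0 : Site P j) = p := by
  obtain ⟨x, μ, ν, h⟩ := p
  simp only [Plaq.translate, add_zero]

/-- **THE CENTRE REFLECTION OF FIELDS ON PLAQUETTE VARIABLES, IN `dist1`**: `dist1 ((c_i U)(∂p)) = dist1 (U(∂(c_i p)))`
(`creflect = reflect ∘ translate (−e_i)`, §2's `dist1_plaqHol_reflect`, the tree's `plaqHol_translate`). [folklore] -/
theorem dist1_plaqHol_creflect (i : Fin P.d) (U : GaugeField P j G) (p : Plaq P j) :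
    dist1 (GaugeField.plaqHol (U.creflect i) p) = dist1 (GaugeField.plaqHol U (cplaq i p)) := by
  rw [GaugeField.creflect_eq, dist1_plaqHol_reflect, GaugeField.plaqHol_translate]
  rfl

/-- reflected labels vs shifted labels: `(−t − 1).val < s ↔ (t + s).val < s` (`s ≤ N`; both say `N ≤ t.val + s`).
[folklore] -/
theorem val_neg_sub_one_lt_iff {N : ℕ} [NeZero N] {s : ℕ} (hs : s ≤ N) (t : ZMod N) :
    (-t - 1).val < s ↔ (t + (s : ZMod N)).val < s := by
  rw [AveragingReflection.val_neg_sub_one, val_add_natCast_lt_iff hs]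
  have := ZMod.val_lt t
  omega

/-- **THE CENTRE REFLECTION CARRIES THE PLAQUETTE BOX TO THE MIRROR BOX**: `c_i p ∈ boxPlaqs P j s ↔ p + s·e_i ∈
boxPlaqs P j s` (`s ≤ N_j`) — the plaquette twin of W3o-3's `cbond_mem_boxBonds_iff`. [folklore] -/
theorem cplaq_mem_boxPlaqs_iff (i : Fin P.d) {s : ℕ} (hs : s ≤ P.sitesPerDir j) (p : Plaq P j) :
    cplaq i p ∈ boxPlaqs P j s ↔ p.translate (axisVec P j i s) ∈ boxPlaqs P j s := by
  have hne : p.μ ≠ p.ν := p.hμν.ne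
  rw [mem_boxPlaqs, mem_boxPlaqs]
  refine forall_congr' fun κ => ?_
  simp only [shift_shift_apply, cplaq_μ, cplaq_ν]
  show ((cplaq i p).src κ).val < s ∧ _ ↔ ((p.src + axisVec P j i s) κ).val < s ∧
    ((p.src + axisVec P j i s) κ + (if κ = p.μ then 1 else 0) + (if κ = p.ν then 1 else 0)).val < s
  rw [Balaban1983to89.Site.add_apply, axisVec_apply]
  by_cases hκ : κ = i
  · subst hκ
    rw [if_pos rfl, cplaq_src_apply_same]
    by_cases hd : p.μ = κ ∨ p.ν = κ
    · rw [if_pos hd]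
      have hone : ((if κ = p.μ then 1 else 0) + (if κ = p.ν then 1 else 0) : ZMod (P.sitesPerDir j)) = 1 := by
        rcases hd with h | h
        · rw [if_pos h.symm, if_neg (fun h' => hne (h.trans h')), add_zero]
        · rw [if_neg (fun h' => hne (h'.symm.trans h.symm)), if_pos h.symm, zero_add]
      rw [add_assoc (p.src κ + (s : ZMod (P.sitesPerDir j))), hone, add_assoc (-p.src κ - 1 - 1), hone,
        show -p.src κ - 1 - 1 = -(p.src κ + 1) - 1 by ring, show -(p.src κ + 1) - 1 + 1 = -p.src κ - 1 by ring,
        show p.src κ + (s : ZMod (P.sitesPerDir j)) + 1 = (p.src κ + 1) + (s : ZMod (P.sitesPerDir j)) by ring,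
        val_neg_sub_one_lt_iff hs, val_neg_sub_one_lt_iff hs, and_comm]
    · rw [if_neg hd]
      have hzero : ((if κ = p.μ then 1 else 0) + (if κ = p.ν then 1 else 0) : ZMod (P.sitesPerDir j)) = 0 := by
        rw [if_neg (fun h' => hd (Or.inl h'.symm)), if_neg (fun h' => hd (Or.inr h'.symm)), add_zero]
      rw [add_assoc (p.src κ + (s : ZMod (P.sitesPerDir j))), hzero, add_assoc (-p.src κ - 1 - 0), hzero, add_zero,
        add_zero, sub_zero, val_neg_sub_one_lt_iff hs]
  · rw [if_neg hκ, add_zero, cplaq_src_apply_of_ne i p hκ]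

/-- **ONE LEVEL**: the `PlaqSmallOn` box event pulled back by the centre reflection equals its pull-back by the
translation to the mirror box (`s ≤ N_j`; `dist1_plaqHol_creflect`, `cplaq_mem_boxPlaqs_iff`, `cplaq_cplaq`).
[folklore] -/
theorem preimage_creflect_plaqSmallOn (i : Fin P.d) {s : ℕ} (hs : s ≤ P.sitesPerDir j) (δ : ℝ) :
    (GaugeField.creflect (P := P) (G := G) i) ⁻¹' {U | PlaqSmallOn (↑(boxPlaqs P j s)) δ U} =
      (GaugeField.translate (-axisVec P j i s)) ⁻¹' {U | PlaqSmallOn (↑(boxPlaqs P j s)) δ U} := by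
  ext U
  simp only [Set.mem_preimage, Set.mem_setOf_eq, PlaqSmallOn, Finset.mem_coe]
  constructor
  · intro h p hp
    have hc : cplaq i (p.translate (-axisVec P j i s)) ∈ boxPlaqs P j s := by
      rw [cplaq_mem_boxPlaqs_iff i hs, plaq_translate_translate, neg_add_cancel, plaq_translate_zero]
      exact hp
    have h' := h _ hc
    rwa [dist1_plaqHol_creflect, cplaq_cplaq, ← GaugeField.plaqHol_translate] at h'
  · intro h p hp
    have hc : (cplaq i p).translate (axisVec P j i s) ∈ boxPlaqs P j s := by
      rw [← cplaq_mem_boxPlaqs_iff i hs, cplaq_cplaq]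
      exact hp
    have h' := h _ hc
    rwa [GaugeField.plaqHol_translate, plaq_translate_translate, add_neg_cancel, plaq_translate_zero,
      ← dist1_plaqHol_creflect] at h'

end Reflect

end

end Summit.QuantumFields.BalabanUV.T4Continuum.HistoryChessboardPlaquetteBox
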